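import Summits.CriticalPhenomena.PercolationContinuityZ3.Theorems.Transplant.SkelPhiForcedColumn
import Summits.CriticalPhenomena.PercolationContinuityZ3.Theorems.Transplant.SkelPhiApronKitDefsQ
import HarnessLib

/-!
# Quasi-step rung (N3-b), BINDER WAVE, row Q06 «SkelPhiForcedColumn» of WAVE-Q-BINDER-rows v0.6 under (ι) := `Skelφ.QStepsN G φ M`: **THE QUASI-COLUMN OF A
# CONTACT** — the straight QUASI-walk `walkQ` of cost `P.N` from the stem end `t₁` along the exit side form's climbing axis to the kit centre's row, AS A VERTEX
# SET the nodes together with their LINK SETS (`linkFinQ`; exact footprint), its end `ctColEndQ`, and the column facts with the radius / cardinality / depth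
# floors `×P.N` — the twins of «SkelPhiForcedColumn» (which assumed `Steps G φ`)

builds on p205010 (kernel theorem, internal audit signed; external expert review pending) — nothing in this file uses p205010; nothing here is a claim about any open node
((N3-b), the end state); no carrier, no node.  Lane `prim-bschramm`, seat `prim-hp-8` (gen 62; binder-wave pen, family Forced*/Root*/RunKits/ApronKitDefs — captain gen-1 g4,
lane INBOX 2026-08-27 07:25Z).  DEF row (two definitions `ctColQ`, `ctColEndQ`, review-queued by D-0009); FLOOR row (`×P.N` in `hr₀`/`hT`/`hDw` and the cardinality
bound — refuter p5-g28's pull list).  Helper file (`--supports stmt-CriticalPhenomena-4575 --as helper`).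
WHY (hunk classes (i) binder `(hstep : Steps G φ) ↦ (hqφ : QStepsN G φ P.N)` — common cost bound of both maps, located item L-hp8-1; (ii) call sites
`walk/φ_walk/walk_adj/walk_mem_graphBall ↦ walkQ/F_walkQ/walkQ_link + linkFinQ/walkQ_mem_graphBall` («SkelPhiQStepsN») and `ctCtr/φ_ctCtr ↦ ctCtrQ/φ_ctCtr_q`
(«SkelPhiApronKitDefsQ», Q02); (iv) radius `KCmax ↦ P.N·KCmax`).  Under unit steps the column was the `K + 1` vertices of a straight `φ`-walk, consecutive ones ADJACENT;
under quasi-steps consecutive NODES `c_k = walkQ … k` are joined by a LINK of length `≤ P.N` all of whose vertices sit AT `φ c_k` or equal `c_{k+1}` (exact footprint,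
`F_of_mem_linkFinQ'`), so the column as a vertex set is `{c_0, …, c_K} ∪ ⋃_{k<K} linkFinQ c_k c_{k+1}`: still `G`-connected from `t₁` inside itself, inside
`B_G(t₁, P.N·KCmax)`, of cardinality `≤ (KCmax+1)(P.N+2)`, and — for a NEAR contact — inside the level window, because EVERY column vertex carries a NODE's `φ`-value, along
which the side form does not decrease (depth `≥ 1 + d`; no collar: the exact footprint).  `kitK_ctT1_le` is `ψ`-only and stays imported.
Regression: `qStepsN_of_steps` (`P.N = 1`).
* `ctColQ`, `ctColEndQ`, `φ_walkQ_lin`, `φ_ctColEnd_q`, `ctT1_mem_ctCol_q`, `ctColEnd_mem_ctCol_q`, `φ_eq_node_of_mem_ctColQ`, `pathIn_ctCol_q`, `ctCol_subset_graphBall_q`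
  (radius `P.N·KCmax`), `card_ctCol_le_q` (`≤ (KCmax+1)(P.N+2)`), **`mem_winLevel_of_mem_ctCol_q`** (floors `hr₀`, `hT`, `hDw` with `P.N·KCmax`).
[cite: KozmaNitzan2024, §4 Lemma 10, p. 21, p. 26 ((29): columns)] [cite: GrimmettPercolation1999, §7.2]
-/

noncomputable section

open scoped Classical

namespace Summit.CriticalPhenomena.PercolationContinuityZ3.Theorems.Transplant

namespace Skelφ

open Literature.Probability.Percolation Literature.Probability.LatticeModels SimpleGraph KNLevels
open Literature.Probability.Percolation.KozmaNitzan.Cells (oth oth_ne eq_oth_of_ne oth_oth)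
open Literature.Barriers.CriticalPhenomena (graphBall graphBall_finite mem_graphBall_self graphBall_mono)
open Skel (winGraph winGraph_adj KitGeom)
open SkelI (tanOff tanTgt tanTgt_mem)

variable {V : Type} [DecidableEq V] {G : SimpleGraph V} [G.LocallyFinite] {ψ φ : V → Site 2}

/-! ## §1 The quasi-column of a contact -/

section Column

variable (G) {Lo Hi : Site 2} (SF : ∀ (i : Fin 2) (σ : ℤˣ), SideForm ψ φ Lo Hi i σ) (P : ApronPrm) (w₀ : V) (R : ℕ)

/-- **The quasi-column** of a contact `x`: the nodes `c_0 = t₁, …, c_K` of the straight quasi-walk of cost `P.N` from the stem end along the climbing axis of the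
exit side form (`K = kitK (φ t₁) D A`) together with the link sets joining consecutive nodes (twin of `ctCol`). [cite: KozmaNitzan2024, §4 p. 26 ((29): columns)] -/
def ctColQ (x : V) : Finset V :=
  (Finset.range ((SF (ctDir G ψ w₀ R Lo Hi x).1 (ctDir G ψ w₀ R Lo Hi x).2).kitK (φ (ctT1 G ψ P w₀ R Lo Hi x)) (shellD P) P.A + 1)).image
      (fun k => walkQ G φ P.N (SF (ctDir G ψ w₀ R Lo Hi x).1 (ctDir G ψ w₀ R Lo Hi x).2).a (SF (ctDir G ψ w₀ R Lo Hi x).1 (ctDir G ψ w₀ R Lo Hi x).2).s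
        (ctT1 G ψ P w₀ R Lo Hi x) k) ∪
    (Finset.range ((SF (ctDir G ψ w₀ R Lo Hi x).1 (ctDir G ψ w₀ R Lo Hi x).2).kitK (φ (ctT1 G ψ P w₀ R Lo Hi x)) (shellD P) P.A)).biUnion
      fun k => linkFinQ G φ P.N
        (walkQ G φ P.N (SF (ctDir G ψ w₀ R Lo Hi x).1 (ctDir G ψ w₀ R Lo Hi x).2).a (SF (ctDir G ψ w₀ R Lo Hi x).1 (ctDir G ψ w₀ R Lo Hi x).2).s
          (ctT1 G ψ P w₀ R Lo Hi x) k)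
        (walkQ G φ P.N (SF (ctDir G ψ w₀ R Lo Hi x).1 (ctDir G ψ w₀ R Lo Hi x).2).a (SF (ctDir G ψ w₀ R Lo Hi x).1 (ctDir G ψ w₀ R Lo Hi x).2).s
          (ctT1 G ψ P w₀ R Lo Hi x) (k + 1))

/-- **The quasi-column's end**: the last node, the quasi-walk vertex over the kit centre's planar point (twin of `ctColEnd`). [folklore] -/
def ctColEndQ (x : V) : V :=
  walkQ G φ P.N (SF (ctDir G ψ w₀ R Lo Hi x).1 (ctDir G ψ w₀ R Lo Hi x).2).a (SF (ctDir G ψ w₀ R Lo Hi x).1 (ctDir G ψ w₀ R Lo Hi x).2).s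
    (ctT1 G ψ P w₀ R Lo Hi x) ((SF (ctDir G ψ w₀ R Lo Hi x).1 (ctDir G ψ w₀ R Lo Hi x).2).kitK (φ (ctT1 G ψ P w₀ R Lo Hi x)) (shellD P) P.A)

variable {G SF P w₀ R}

omit [DecidableEq V] [G.LocallyFinite] in
/-- The side form along a straight quasi-walk on its climbing axis: `L(φ c_k) = L(φ v) + k·(s c_a)` (twin of `φ_walk_lin`). [folklore] -/
theorem φ_walkQ_lin {N : ℕ} (hqφ : QStepsN G φ N) {i₀ : Fin 2} {σ₀ : ℤˣ} (F : SideForm ψ φ Lo Hi i₀ σ₀) (v : V) (k : ℕ) :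
    F.lin (φ (walkQ G φ N F.a F.s v k)) = F.lin (φ v) + (k : ℤ) * ((F.s : ℤ) * coef F.cα F.cβ F.a) := by
  rw [F_walkQ hqφ]
  unfold SideForm.lin
  rw [linForm_add_single]; ring

omit [DecidableEq V] [G.LocallyFinite] in
/-- **The quasi-column ends over the kit centre's planar point**: `φ (ctColEndQ x) = kitPt (φ t₁) D A = φ (ctCtrQ x)` (twin of `φ_ctColEnd`). [folklore] -/
theorem φ_ctColEnd_q (hqφ : QStepsN G φ P.N) (x : V) : φ (ctColEndQ G SF P w₀ R x) = φ (ctCtrQ G SF P w₀ R x) := by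
  rw [φ_ctCtr_q SF hqφ]
  unfold ctColEndQ SideForm.kitPt
  rw [F_walkQ hqφ]

omit [G.LocallyFinite] in
/-- The stem end is the quasi-column's first node (twin of `ctT1_mem_ctCol`). [folklore] -/
theorem ctT1_mem_ctCol_q (x : V) : ctT1 G ψ P w₀ R Lo Hi x ∈ ctColQ G SF P w₀ R x := by
  unfold ctColQ
  exact Finset.mem_union_left _ (Finset.mem_image.2 ⟨0, Finset.mem_range.2 (Nat.succ_pos _), rfl⟩)

omit [G.LocallyFinite] in
/-- The quasi-column's end belongs to the quasi-column (twin of `ctColEnd_mem_ctCol`). [folklore] -/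
theorem ctColEnd_mem_ctCol_q (x : V) : ctColEndQ G SF P w₀ R x ∈ ctColQ G SF P w₀ R x := by
  unfold ctColQ ctColEndQ
  exact Finset.mem_union_left _ (Finset.mem_image.2 ⟨_, Finset.mem_range.2 (Nat.lt_succ_self _), rfl⟩)

omit [G.LocallyFinite] in
/-- **Exact footprint of the quasi-column**: every vertex of the quasi-column carries the `φ`-value of a NODE `c_k`, `k ≤ K`. [folklore] -/
theorem φ_eq_node_of_mem_ctColQ (x : V) {v : V} (hv : v ∈ ctColQ G SF P w₀ R x) :
    ∃ k ≤ (SF (ctDir G ψ w₀ R Lo Hi x).1 (ctDir G ψ w₀ R Lo Hi x).2).kitK (φ (ctT1 G ψ P w₀ R Lo Hi x)) (shellD P) P.A,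
      φ v = φ (walkQ G φ P.N (SF (ctDir G ψ w₀ R Lo Hi x).1 (ctDir G ψ w₀ R Lo Hi x).2).a (SF (ctDir G ψ w₀ R Lo Hi x).1 (ctDir G ψ w₀ R Lo Hi x).2).s
        (ctT1 G ψ P w₀ R Lo Hi x) k) := by
  unfold ctColQ at hv
  rcases Finset.mem_union.1 hv with hv | hv
  · obtain ⟨k, hk, rfl⟩ := Finset.mem_image.1 hv
    exact ⟨k, Nat.lt_succ_iff.1 (Finset.mem_range.1 hk), rfl⟩
  · obtain ⟨k, hk, hu⟩ := Finset.mem_biUnion.1 hv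
    have hk' := Finset.mem_range.1 hk
    rcases F_of_mem_linkFinQ' hu with h | rfl
    · exact ⟨k, hk'.le, h⟩
    · exact ⟨k + 1, hk', rfl⟩

omit [G.LocallyFinite] in
/-- **The quasi-column is `G`-connected from the stem end inside itself** (under `QStepsN` of the base chart; twin of `pathIn_ctCol`). [folklore] -/
theorem pathIn_ctCol_q (hqφ : QStepsN G φ P.N) (x : V) :
    ∀ v ∈ ctColQ G SF P w₀ R x, PathIn G (↑(ctColQ G SF P w₀ R x) : Set V) (ctT1 G ψ P w₀ R Lo Hi x) v := by
  intro v hv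
  set F := SF (ctDir G ψ w₀ R Lo Hi x).1 (ctDir G ψ w₀ R Lo Hi x).2 with hF
  set t₁ := ctT1 G ψ P w₀ R Lo Hi x with ht₁
  set K := F.kitK (φ t₁) (shellD P) P.A with hK
  set c := walkQ G φ P.N F.a F.s t₁ with hc
  have hnode : ∀ m ≤ K, c m ∈ (↑(ctColQ G SF P w₀ R x) : Set V) := fun m hm =>
    Finset.mem_coe.2 (Finset.mem_union_left _ (Finset.mem_image.2 ⟨m, Finset.mem_range.2 (Nat.lt_succ_iff.2 hm), rfl⟩))
  have hlink : ∀ m < K, ∀ u ∈ linkFinQ G φ P.N (c m) (c (m + 1)), u ∈ (↑(ctColQ G SF P w₀ R x) : Set V) := fun m hm u hu =>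
    Finset.mem_coe.2 (Finset.mem_union_right _ (Finset.mem_biUnion.2 ⟨m, Finset.mem_range.2 hm, hu⟩))
  -- the nodes are reached along the chain of links
  have hchain : ∀ m ≤ K, PathIn G (↑(ctColQ G SF P w₀ R x) : Set V) t₁ (c m) := by
    intro m hm
    induction m with
    | zero => exact PathIn.refl (hnode 0 (Nat.zero_le _))
    | succ m ih =>
      exact (ih (by omega)).trans (pathIn_of_linkFinQ_subset (hlink m (by omega)) _ (right_mem_linkFinQ (walkQ_link hqφ F.a F.s t₁ m)))
  unfold ctColQ at hv
  rcases Finset.mem_union.1 hv with hv | hv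
  · obtain ⟨k, hk, rfl⟩ := Finset.mem_image.1 hv
    exact hchain k (Nat.lt_succ_iff.1 (Finset.mem_range.1 hk))
  · obtain ⟨k, hk, hu⟩ := Finset.mem_biUnion.1 hv
    have hk' := Finset.mem_range.1 hk
    exact (hchain k hk'.le).trans (pathIn_of_linkFinQ_subset (hlink k hk') _ hu)

/-- **The quasi-column lies in the graph ball of radius `P.N · KCmax` about the stem end** (radius `×P.N`; twin of `ctCol_subset_graphBall`). [folklore] -/
theorem ctCol_subset_graphBall_q (hlip : Lip G ψ) (hq : QStepsN G ψ P.N) (hqφ : QStepsN G φ P.N) (hw2 : ∀ i, Lo i + 2 ≤ Hi i) {KCmax : ℕ}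
    (hKC : ∀ (i : Fin 2) (σ : ℤˣ) (z : Site 2), (SF i σ).θ (1 + P.d) ≤ (SF i σ).lin z → (SF i σ).lin z < (SF i σ).θ (2 + P.d) →
      (SF i σ).kitK z (shellD P) P.A ≤ KCmax)
    {x : V} (hx : x ∈ outerBoundary (winGraph G w₀ R) (Win G ψ w₀ (Finset.Icc Lo Hi) R)) :
    ∀ v ∈ ctColQ G SF P w₀ R x, v ∈ graphBall G (ctT1 G ψ P w₀ R Lo Hi x) (P.N * KCmax) := by
  intro v hv
  have hK := kitK_ctT1_le (SF := SF) hlip hq hw2 hKC hx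
  unfold ctColQ at hv
  rcases Finset.mem_union.1 hv with hv | hv
  · obtain ⟨k, hk, rfl⟩ := Finset.mem_image.1 hv
    have hk' := Nat.lt_succ_iff.1 (Finset.mem_range.1 hk)
    exact graphBall_mono G _ (Nat.mul_le_mul_left P.N (hk'.trans hK)) (walkQ_mem_graphBall hqφ _ _ _ k)
  · obtain ⟨k, hk, hu⟩ := Finset.mem_biUnion.1 hv
    have hk' : k + 1 ≤ KCmax := (Nat.succ_le_of_lt (Finset.mem_range.1 hk)).trans hK
    have h := BoxProdZ2.mem_graphBall_add G (walkQ_mem_graphBall hqφ _ _ (ctT1 G ψ P w₀ R Lo Hi x) k) (linkFinQ_subset_graphBall _ _ _ _ hu)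
    refine graphBall_mono G _ ?_ h
    calc P.N * k + P.N = P.N * (k + 1) := by ring
      _ ≤ P.N * KCmax := Nat.mul_le_mul_left P.N hk'

/-- The quasi-column has at most `(KCmax + 1)·(P.N + 2)` vertices (`K + 1` nodes and `K` links of `≤ P.N + 1` vertices; FLOOR `×P.N`; twin of `card_ctCol_le`).
[folklore] -/
theorem card_ctCol_le_q (hlip : Lip G ψ) (hq : QStepsN G ψ P.N) (hw2 : ∀ i, Lo i + 2 ≤ Hi i) {KCmax : ℕ}
    (hKC : ∀ (i : Fin 2) (σ : ℤˣ) (z : Site 2), (SF i σ).θ (1 + P.d) ≤ (SF i σ).lin z → (SF i σ).lin z < (SF i σ).θ (2 + P.d) →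
      (SF i σ).kitK z (shellD P) P.A ≤ KCmax)
    {x : V} (hx : x ∈ outerBoundary (winGraph G w₀ R) (Win G ψ w₀ (Finset.Icc Lo Hi) R)) :
    (ctColQ G SF P w₀ R x).card ≤ (KCmax + 1) * (P.N + 2) := by
  have hK := kitK_ctT1_le (SF := SF) hlip hq hw2 hKC hx
  unfold ctColQ
  set K := (SF (ctDir G ψ w₀ R Lo Hi x).1 (ctDir G ψ w₀ R Lo Hi x).2).kitK (φ (ctT1 G ψ P w₀ R Lo Hi x)) (shellD P) P.A with hKdef
  refine (Finset.card_union_le _ _).trans ?_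
  have h1 : ((Finset.range (K + 1)).image fun k => walkQ G φ P.N (SF (ctDir G ψ w₀ R Lo Hi x).1 (ctDir G ψ w₀ R Lo Hi x).2).a
      (SF (ctDir G ψ w₀ R Lo Hi x).1 (ctDir G ψ w₀ R Lo Hi x).2).s (ctT1 G ψ P w₀ R Lo Hi x) k).card ≤ K + 1 :=
    Finset.card_image_le.trans (by rw [Finset.card_range])
  have h2 : ((Finset.range K).biUnion fun k => linkFinQ G φ P.N
      (walkQ G φ P.N (SF (ctDir G ψ w₀ R Lo Hi x).1 (ctDir G ψ w₀ R Lo Hi x).2).a (SF (ctDir G ψ w₀ R Lo Hi x).1 (ctDir G ψ w₀ R Lo Hi x).2).s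
        (ctT1 G ψ P w₀ R Lo Hi x) k)
      (walkQ G φ P.N (SF (ctDir G ψ w₀ R Lo Hi x).1 (ctDir G ψ w₀ R Lo Hi x).2).a (SF (ctDir G ψ w₀ R Lo Hi x).1 (ctDir G ψ w₀ R Lo Hi x).2).s
        (ctT1 G ψ P w₀ R Lo Hi x) (k + 1))).card ≤ K * (P.N + 1) := by
    refine Finset.card_biUnion_le.trans ?_
    calc ∑ k ∈ Finset.range K, (linkFinQ G φ P.N
            (walkQ G φ P.N (SF (ctDir G ψ w₀ R Lo Hi x).1 (ctDir G ψ w₀ R Lo Hi x).2).a (SF (ctDir G ψ w₀ R Lo Hi x).1 (ctDir G ψ w₀ R Lo Hi x).2).s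
              (ctT1 G ψ P w₀ R Lo Hi x) k)
            (walkQ G φ P.N (SF (ctDir G ψ w₀ R Lo Hi x).1 (ctDir G ψ w₀ R Lo Hi x).2).a (SF (ctDir G ψ w₀ R Lo Hi x).1 (ctDir G ψ w₀ R Lo Hi x).2).s
              (ctT1 G ψ P w₀ R Lo Hi x) (k + 1))).card
        ≤ ∑ _k ∈ Finset.range K, (P.N + 1) := Finset.sum_le_sum fun k _ => card_linkFinQ_le _ _ _
      _ = K * (P.N + 1) := by rw [Finset.sum_const, Finset.card_range, smul_eq_mul]
  have h3 : K + 1 + K * (P.N + 1) ≤ (KCmax + 1) * (P.N + 2) := by nlinarith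
  omega

/-- **The quasi-column of a near contact lies in the level window**: its vertices carry node values of `φ`, hence sit at depth `≥ 1 + d` (the side form increases
along the nodes) and `≤ 1 + d + P.N·KCmax`, tangentially within `P.N·KCmax ≤ T₀` of the clamped target, and within `r₀` of the inner neighbour (FLOORS `hr₀`, `hT`, `hDw`
`×P.N`; twin of `mem_winLevel_of_mem_ctCol`). [this work] -/
theorem mem_winLevel_of_mem_ctCol_q (hlip : Lip G ψ) (hq : QStepsN G ψ P.N) (hqφ : QStepsN G φ P.N) (hwide : ∀ i, Lo i + 2 * tanOff P.ℓs P.M ≤ Hi i)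
    {KCmax : ℕ}
    (hKC : ∀ (i : Fin 2) (σ : ℤˣ) (z : Site 2), (SF i σ).θ (1 + P.d) ≤ (SF i σ).lin z → (SF i σ).lin z < (SF i σ).θ (2 + P.d) →
      (SF i σ).kitK z (shellD P) P.A ≤ KCmax)
    (hr₀ : P.N * (tanOff P.ℓs P.M + 1) + P.N * P.d + P.N * KCmax ≤ P.r₀) (hR : P.r₀ ≤ R) (hT : ((P.N * KCmax : ℕ) : ℤ) ≤ tanOff P.ℓs P.M)
    (hDw : ∀ i, Lo i + ((1 + P.d + P.N * KCmax : ℕ) : ℤ) ≤ Hi i)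
    {x : V} (hx : x ∈ outerBoundary (winGraph G w₀ R) (Win G ψ w₀ (Finset.Icc Lo Hi) R)) (hnear : IsNear G ψ Lo Hi P w₀ R x) :
    ∀ v ∈ ctColQ G SF P w₀ R x, v ∈ Win G ψ w₀ (Finset.Icc Lo Hi) R := by
  intro v hv
  have hw2 : ∀ i, Lo i + 2 ≤ Hi i := fun i => by have := hwide i; unfold tanOff at this; omega
  have ht := ψ_ctT1 hlip hq hw2 hx
  set F := SF (ctDir G ψ w₀ R Lo Hi x).1 (ctDir G ψ w₀ R Lo Hi x).2 with hF
  set t₁ := ctT1 G ψ P w₀ R Lo Hi x with ht₁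
  have hvt : v ∈ graphBall G t₁ (P.N * KCmax) := ctCol_subset_graphBall_q hlip hq hqφ hw2 hKC hx v hv
  -- the form does not decrease along the nodes, and every column vertex carries a node value: depth `≥ 1 + d`
  have hdepth : 1 + (P.d : ℤ) ≤ sdepth ψ Lo Hi (ctDir G ψ w₀ R Lo Hi x).1 (ctDir G ψ w₀ R Lo Hi x).2 v := by
    obtain ⟨k, -, hk⟩ := φ_eq_node_of_mem_ctColQ (SF := SF) x hv
    refine F.le_sdepth_of_lin ?_
    unfold SideForm.lin
    rw [hk]
    have hlin := φ_walkQ_lin hqφ F t₁ k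
    unfold SideForm.lin at hlin
    rw [hlin]
    have h0 : F.θ (1 + P.d) ≤ F.lin (φ t₁) := F.le_lin_of_le_sdepth (by rw [ht.1])
    unfold SideForm.lin at h0
    have hC := F.clim_pos
    nlinarith
  rw [mem_Win]
  refine ⟨?_, ?_⟩
  · -- inside `B_G(w₀, R)`
    have hvy : v ∈ graphBall G (ctY G ψ w₀ R Lo Hi x) (P.N * (tanOff P.ℓs P.M + 1) + P.N * P.d + P.N * KCmax) :=
      BoxProdZ2.mem_graphBall_add G (ctT1_mem_graphBall hq hwide hx) hvt
    have h := BoxProdZ2.mem_graphBall_add G hnear (graphBall_mono G _ hr₀ hvy)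
    rwa [Nat.sub_add_cancel hR] at h
  · -- planar window coordinates in the box
    have hexit := sdepth_sub_le_of_mem_graphBall hlip (Lo := Lo) (Hi := Hi) (ctDir G ψ w₀ R Lo Hi x).1 (ctDir G ψ w₀ R Lo Hi x).2 hvt
    rw [ht.1, abs_le] at hexit
    have htan := abs_sub_le_of_mem_graphBall hlip hvt (oth (ctDir G ψ w₀ R Lo Hi x).1)
    rw [ht.2, abs_le] at htan
    have hτ := tanTgt_mem (oth (ctDir G ψ w₀ R Lo Hi x).1) (hwide (oth _)) (ψ (ctY G ψ w₀ R Lo Hi x))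
    have hwid := hDw (ctDir G ψ w₀ R Lo Hi x).1
    push_cast at hexit htan hwid hT
    rw [Finset.mem_Icc]
    constructor <;> intro i
    · by_cases hi : i = (ctDir G ψ w₀ R Lo Hi x).1
      · rw [hi]; unfold sdepth at hdepth hexit; split_ifs at hdepth hexit <;> linarith [hexit.1, hexit.2]
      · rw [eq_oth_of_ne hi]; linarith [htan.1, hτ.1]
    · by_cases hi : i = (ctDir G ψ w₀ R Lo Hi x).1
      · rw [hi]; unfold sdepth at hdepth hexit; split_ifs at hdepth hexit <;> linarith [hexit.1, hexit.2]
      · rw [eq_oth_of_ne hi]; linarith [htan.2, hτ.2]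

end Column

end Skelφ

end Summit.CriticalPhenomena.PercolationContinuityZ3.Theorems.Transplant

end
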